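import Summits.ABC.IUTFork.Cor312SlotHullLocal
import Summits.ABC.IUTFork.Cor312ThetaLocalLeContentHull
import HarnessLib

/-!
# [IUTchIII] Corollary 3.12 IN READING (P) — the SLOT-HULL local term of ANY typed setting over a `p`-adic presentation is bounded ABOVE
# by the per-summand content hulls for ANY exponent family: `−|log(Θ)|^{(P)}_{j,v_ℚ} ≤ Σ_{v⃗} w(v⃗)·(−m(v⃗)·log p + log μ̄_{v⃗}(hull(log_p(R_{v⃗}^×))))`

PROOF-ONLY file (D-0012; no definitions, no `Prop` facts) of the abc-iut cell (R2 S-chain team, seat abc-iut-s2-p7 gen 3, CLAIM «HΘP-K»: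
the READ-P binder `hReadP` of abc-iut-C-cert-2's γ certificate `Conditional.abc_of_slotLicence_orNumP_K_szpiroBad`, p458998). The
(Ind2)-SLOT-HULL twin of this seat's `Cor312ThetaLocalLeContentHull` (p437184). TAKES NO SIDE on [IUTchIII] Cor. 3.12 or on the reading
(U)/(P) of `−|log(Θ)|`.

S. Mochizuki, *Inter-universal Teichmüller theory III* [Mochizuki2012]: Thm. 3.11 (i) (Ind2) p. 154 («independent copies of Ism … on each of
the direct summands of the `j+1` factors»), Cor. 3.12 proof Step (x) p. 181; *IUT IV* Thm. 1.10 Step (v) p. 27–28; T. Dupuy, A. Hilado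
[DupuyHilado2025] §4.9 (Ism ⊆ lattice automorphisms), §4.11–4.12. For a setting `P` whose hull frame at `(j, v_ℚ)`, `j = i+1`, is the
pulled-back real frame of a presentation `Pr` (`hframe`) with the weighted summand log-measure on product regions (`hvol`), a MONOTONE
log-volume (`hmono`, abc-iut-c312-6 `LogvolMono`) and a hull for the slot union (`hdef`, `SlotHullDefined`):

* `sUnion_thetaSlotImages_subset_preimage_pi` — the union of the (Ind2)-slot images stays in `e⁻¹(Π_{v⃗} Λ_{v⃗})` for ANY (Ind2)-stable summand
  family `Λ` containing the region: NO permutation compatibility is asked, since no capsule permutation acts (abc-iut-w5-d250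
  `ism_image_preimage_pi`); in particular in `e⁻¹(Π_{v⃗} p^{m(v⃗)}·log_p(R_{v⃗}^×))` for ANY exponent family `m`;
* `thetaSlotLocal_untopD_le_logvol_of_subset`, `thetaSlotLocal_untopD_le_sum_of_ind2Stable_family`, `thetaSlotLocal_untopD_le_sum_content`,
  **`thetaSlotLocal_untopD_le_sum_content_hull`** — the upper bounds of p437184 with (Ind1) switched off: NO capsule symmetry of `m`.

[cite: Mochizuki2012, IUTchIII Thm. 3.11 (i) (Ind2) p. 154; Cor. 3.12 proof Step (x) p. 181] [cite: Mochizuki2012, IUTchIV Thm. 1.10 Step (v)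
p. 27–28; Prop. 1.4 (iii) p. 15] [cite: DupuyHilado2025, §4.9, §4.11, §4.12] [claim: Mochizuki2012, status: disputed] for every quoted
construction. HONEST FRAMING: inequalities between OUR typed objects; reading (P) is a STRONGER-THAN-PRINT reading of Step (x)/(xi-f) (print:
hull of the union of ALL possible images); nothing here asserts or denies Cor. 3.12 or takes a side on any author; typed ≠ proved.
-/

noncomputable section

open Set Function
open scoped Pointwise


/-! ## The UPPER bound: (Ind2)-slot images stay in `e⁻¹(Π_{v⃗} p^{m(v⃗)}·log_p(R_{v⃗}^×))` for ANY exponent family -/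

namespace Summit.ABC.IUTFork.Cor312Vol

open Thm311 Cor312 Literature.IUT.LogThetaLattice Literature.IUT.LogVolume PadicPresentation

section Setting

variable {T : ThetaIndex} {S : Situation T} {P : Cor312.Setting S} {vQ : T.VQ} {p : ℕ} [hp : Fact p.Prime]
  (Pr : PadicPresentation S.L vQ p)

/-- **The union of the (Ind2)-SLOT images lies in `e⁻¹(Π_{v⃗} Λ_{v⃗})`** as soon as the (Ind3)-region does, for ANY (Ind2)-stable summand
family `Λ` — no permutation compatibility is asked, since no capsule permutation acts (abc-iut-w5-d250 `ism_image_preimage_pi`).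
[cite: Mochizuki2012, IUTchIII Thm. 3.11 (i) (Ind2) p. 154] [cite: DupuyHilado2025, §4.9, §4.11] -/
theorem sUnion_thetaSlotImages_subset_preimage_pi (j : T.Label) (Λ : ∀ e : T.Caps j → T.Fibre vQ, Set (Pr.X e))
    (hind : ∀ (e : T.Caps j → T.Fibre vQ) (ψ : Pr.X e ≃ₗ[ℚ_[p]] Pr.X e), ψ ∈ indTwo p (Pr.kk e) → ψ '' Λ e = Λ e)
    (h3 : P.thetaRegion3 j vQ ⊆ Pr.comparison j ⁻¹' Set.pi univ Λ) :
    ⋃₀ P.thetaSlotImages j vQ ⊆ Pr.comparison j ⁻¹' Set.pi univ Λ := by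
  rintro x ⟨U, ⟨Φ, hΦ, rfl⟩, hx⟩
  obtain ⟨g, hg, hΦj⟩ := hΦ j vQ
  have himg : Φ j vQ '' (Pr.comparison j ⁻¹' Set.pi univ Λ) = Pr.comparison j ⁻¹' Set.pi univ Λ := by
    rw [hΦj]
    exact Pr.ism_image_preimage_pi Λ hind g hg
  rw [← himg]
  exact Set.image_mono h3 hx

/-- The union of the (Ind2)-slot images lies in `e⁻¹(Π_{v⃗} p^{m(v⃗)}·log_p(R_{v⃗}^×))` as soon as the (Ind3)-region does, for ANY
exponent family `m` (an element of Ism maps `c·log_p(R_I^×)` onto itself, this seat's `image_smul_logPacket_of_mem_indTwo`).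
[cite: Mochizuki2012, IUTchIV Thm. 1.10 Step (v) p. 27–28] [cite: DupuyHilado2025, §4.9] -/
theorem sUnion_thetaSlotImages_subset_preimage_pi_zpow_smul_logPacket (j : T.Label)
    (m : (T.Caps j → T.Fibre vQ) → ℤ)
    (h3 : P.thetaRegion3 j vQ ⊆ Pr.comparison j ⁻¹' Set.pi univ fun e =>
      ((p : ℚ_[p]) ^ m e) • (logPacket p (Pr.kk e) : Set (Pr.X e))) :
    ⋃₀ P.thetaSlotImages j vQ ⊆ Pr.comparison j ⁻¹' Set.pi univ fun e =>
      ((p : ℚ_[p]) ^ m e) • (logPacket p (Pr.kk e) : Set (Pr.X e)) :=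
  sUnion_thetaSlotImages_subset_preimage_pi Pr j _ (fun _ _ hψ => Pr.image_smul_logPacket_of_mem_indTwo hψ _) h3

/-- **`(−|log(Θ)|^{(P)}_{j,v_ℚ}).untopD 0 ≤ log-vol(H)` for every hull-set `H` containing the slot images** (hull minimality and monotone
log-volume on admissible regions). [cite: Mochizuki2012, IUTchIII Rmk. 3.9.5 (i), (ii) p. 127] -/
theorem thetaSlotLocal_untopD_le_logvol_of_subset (hmono : LogvolMono P) (i : Fin T.lstar)
    (hdef : P.SlotHullDefined (Cor312.Setting.labelSucc i) vQ)
    {Hs : Set (S.L.Packet (Cor312.Setting.labelSucc i) vQ)}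
    (hsub : ⋃₀ P.thetaSlotImages (Cor312.Setting.labelSucc i) vQ ⊆ Hs)
    (hHul : Hs ∈ (P.frame (Cor312.Setting.labelSucc i) vQ).Hul) :
    (P.thetaSlotLocal (Cor312.Setting.labelSucc i) vQ).untopD 0 ≤
      (S.D P.n).logvol (Cor312.Setting.labelSucc i) vQ Hs := by
  rw [P.thetaSlotLocal_untopD_eq hdef]
  exact hmono i vQ (P.thetaSlotHull_adm hdef) (P.hul_adm _ vQ _ hHul)
    ((P.frame (Cor312.Setting.labelSucc i) vQ).hull_subset_of_mem hHul hsub)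

/-- **`−|log(Θ)|^{(P)}_{j,v_ℚ} ≤ Σ_{v⃗} w(v⃗)·log μ̄_{v⃗}(g_{v⃗}·(R_I)^∼)` for any (Ind2)-STABLE family trapped in nondegenerate translates** —
the slot twin of this seat's `thetaLocal_untopD_le_sum_of_stable_family` (p437184), with NO permutation compatibility: if the (Ind3)-region
lies in `e⁻¹(Π_{v⃗} Λ_{v⃗})` for an (Ind2)-stable `Λ` with `Λ_{v⃗} ⊆ g_{v⃗}·(R_I)^∼`, then the slot hull lies in the hull-set
`e⁻¹(Π_{v⃗} g_{v⃗}·(R_I)^∼)` and the local slot term is at most its log-volume. [cite: Mochizuki2012, IUTchIV Thm. 1.10 Step (v) p. 27–28]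
[cite: DupuyHilado2025, §4.12] -/
theorem thetaSlotLocal_untopD_le_sum_of_ind2Stable_family (hmono : LogvolMono P) (i : Fin T.lstar)
    [Fintype (Pr.factorIdx (Cor312.Setting.labelSucc i))] [Fintype (T.Caps (Cor312.Setting.labelSucc i) → T.Fibre vQ)]
    (hdef : P.SlotHullDefined (Cor312.Setting.labelSucc i) vQ)
    (hframe : P.frame (Cor312.Setting.labelSucc i) vQ =
      HullFrame.ofComparison (Pr.factorField (Cor312.Setting.labelSucc i))
        (fun x => Pr.factorMap (Cor312.Setting.labelSucc i) x))
    (hvol : ∀ R : ∀ e : T.Caps (Cor312.Setting.labelSucc i) → T.Fibre vQ, Set (Pr.X e),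
      (∀ e, PacketAdm p (Pr.kk e) (R e)) →
        (S.D P.n).logvol (Cor312.Setting.labelSucc i) vQ
          (Pr.comparison (Cor312.Setting.labelSucc i) ⁻¹' Set.pi univ R) =
        ∑ e, Pr.w (Cor312.Setting.labelSucc i) e * packetLogμ p (Pr.kk e) (R e))
    (Λ : ∀ e : T.Caps (Cor312.Setting.labelSucc i) → T.Fibre vQ, Set (Pr.X e))
    (hind : ∀ (e : T.Caps (Cor312.Setting.labelSucc i) → T.Fibre vQ) (ψ : Pr.X e ≃ₗ[ℚ_[p]] Pr.X e),
      ψ ∈ indTwo p (Pr.kk e) → ψ '' Λ e = Λ e)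
    (h3 : P.thetaRegion3 (Cor312.Setting.labelSucc i) vQ ⊆
      Pr.comparison (Cor312.Setting.labelSucc i) ⁻¹' Set.pi univ Λ)
    (g : ∀ e : T.Caps (Cor312.Setting.labelSucc i) → T.Fibre vQ, Pr.X e)
    (hg : ∀ e k, dEquiv p (Pr.kk e) (g e) k ≠ 0)
    (hΛg : ∀ e, Λ e ⊆ g e • (normalizedPacket p (Pr.kk e) : Set (Pr.X e))) :
    (P.thetaSlotLocal (Cor312.Setting.labelSucc i) vQ).untopD 0 ≤
      ∑ e, Pr.w (Cor312.Setting.labelSucc i) e *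
        packetLogμ p (Pr.kk e) (g e • (normalizedPacket p (Pr.kk e) : Set (Pr.X e))) := by
  have hHul : (Pr.comparison (Cor312.Setting.labelSucc i) ⁻¹' Set.pi univ fun e =>
      g e • (normalizedPacket p (Pr.kk e) : Set (Pr.X e))) ∈ (P.frame (Cor312.Setting.labelSucc i) vQ).Hul := by
    rw [hframe]
    exact Pr.preimage_pi_smul_normalizedPacket_mem_hul g hg
  have hle := thetaSlotLocal_untopD_le_logvol_of_subset hmono i hdef
    ((sUnion_thetaSlotImages_subset_preimage_pi Pr _ Λ hind h3).trans
      (Set.preimage_mono (Set.pi_mono fun e _ => hΛg e))) hHul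
  rw [hvol _ (fun e => packetAdm_smul_normalizedPacket p (Pr.kk e) (g e) (hg e))] at hle
  exact hle

/-- **THE CONTENT FORM — `−|log(Θ)|^{(P)}_{j,v_ℚ} ≤ Σ_{v⃗} w(v⃗)·(−m(v⃗)·log p + Σ_a log ‖h_{v⃗,a}‖)`** for ANY exponent family `m` with
the (Ind3)-region inside `e⁻¹(Π_{v⃗} p^{m(v⃗)}·log_p(R_{v⃗}^×))` and `log_p(R_{v⃗}^×) ⊆ (⊗_a h_{v⃗,a})·(R_I)^∼`, all `h_{v⃗,a} ≠ 0` — the slot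
twin of this seat's `thetaLocal_untopD_le_sum_content` (NO capsule symmetry). [cite: Mochizuki2012, IUTchIV Thm. 1.10 Step (v) p. 27–28]
[cite: Mochizuki2012, IUTchIV Prop. 1.4 (iii) p. 15] -/
theorem thetaSlotLocal_untopD_le_sum_content (hmono : LogvolMono P) (i : Fin T.lstar)
    [Fintype (Pr.factorIdx (Cor312.Setting.labelSucc i))] [Fintype (T.Caps (Cor312.Setting.labelSucc i) → T.Fibre vQ)]
    (hdef : P.SlotHullDefined (Cor312.Setting.labelSucc i) vQ)
    (hframe : P.frame (Cor312.Setting.labelSucc i) vQ =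
      HullFrame.ofComparison (Pr.factorField (Cor312.Setting.labelSucc i))
        (fun x => Pr.factorMap (Cor312.Setting.labelSucc i) x))
    (hvol : ∀ R : ∀ e : T.Caps (Cor312.Setting.labelSucc i) → T.Fibre vQ, Set (Pr.X e),
      (∀ e, PacketAdm p (Pr.kk e) (R e)) →
        (S.D P.n).logvol (Cor312.Setting.labelSucc i) vQ
          (Pr.comparison (Cor312.Setting.labelSucc i) ⁻¹' Set.pi univ R) =
        ∑ e, Pr.w (Cor312.Setting.labelSucc i) e * packetLogμ p (Pr.kk e) (R e))
    (m : (T.Caps (Cor312.Setting.labelSucc i) → T.Fibre vQ) → ℤ)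
    (h3 : P.thetaRegion3 (Cor312.Setting.labelSucc i) vQ ⊆
      Pr.comparison (Cor312.Setting.labelSucc i) ⁻¹' Set.pi univ fun e =>
        ((p : ℚ_[p]) ^ m e) • (logPacket p (Pr.kk e) : Set (Pr.X e)))
    (h : ∀ e : T.Caps (Cor312.Setting.labelSucc i) → T.Fibre vQ, ∀ a, Pr.kk e a)
    (hh : ∀ e a, h e a ≠ 0)
    (hsub : ∀ e, (logPacket p (Pr.kk e) : Set (Pr.X e)) ⊆
      purePacket p (Pr.kk e) (h e) • (normalizedPacket p (Pr.kk e) : Set (Pr.X e))) :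
    (P.thetaSlotLocal (Cor312.Setting.labelSucc i) vQ).untopD 0 ≤
      ∑ e, Pr.w (Cor312.Setting.labelSucc i) e * (-(m e * Real.log p) + ∑ a, Real.log ‖h e a‖) := by
  haveI : Nonempty (T.Caps (Cor312.Setting.labelSucc i)) := ⟨0⟩
  -- the enclosing translates `(p^{m(v⃗)}·⊗_a h_{v⃗,a})·(R_I)^∼`
  set g : ∀ e : T.Caps (Cor312.Setting.labelSucc i) → T.Fibre vQ, Pr.X e :=
    fun e => ppow p (Pr.kk e) (m e) * purePacket p (Pr.kk e) (h e) with hgdef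
  have hg : ∀ e k, dEquiv p (Pr.kk e) (g e) k ≠ 0 := by
    intro e k
    rw [hgdef, map_mul, Pi.mul_apply]
    exact mul_ne_zero
      (((isUnit_ppow p (Pr.kk e) (m e)).map (dEquiv p (Pr.kk e))).map (Pi.evalRingHom _ k)).ne_zero
      (dEquiv_purePacket_ne_zero p (Pr.kk e) (hh e) k)
  have hΛg : ∀ e, ((p : ℚ_[p]) ^ m e) • (logPacket p (Pr.kk e) : Set (Pr.X e)) ⊆
      g e • (normalizedPacket p (Pr.kk e) : Set (Pr.X e)) := by
    intro e
    rw [hgdef, mul_smul, ← ppow_smul_set_eq]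
    exact Set.smul_set_mono (hsub e)
  have hle := thetaSlotLocal_untopD_le_sum_of_ind2Stable_family Pr hmono i hdef hframe hvol
    (fun e => ((p : ℚ_[p]) ^ m e) • (logPacket p (Pr.kk e) : Set (Pr.X e)))
    (fun e ψ hψ => Pr.image_smul_logPacket_of_mem_indTwo hψ _) h3 g hg hΛg
  refine hle.trans (le_of_eq (Finset.sum_congr rfl fun e _ => ?_))
  rw [hgdef]
  exact congrArg _ (packetLogVolume_ppow_mul_purePacket_smul p (Pr.kk e) (DFac p (Pr.kk e)) (dEquiv p (Pr.kk e))
    (m e) (h e) (hh e))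

/-- **THE CONTENT-HULL FORM — `(−|log(Θ)|^{(P)}_{j,v_ℚ}).untopD 0 ≤ Σ_{v⃗} w(v⃗)·(−m(v⃗)·log p + log μ̄_{v⃗}(hull(log_p(R_{v⃗}^×))))`** for ANY
exponent family `m` with the (Ind3)-region inside `e⁻¹(Π_{v⃗} p^{m(v⃗)}·log_p(R_{v⃗}^×))` — the slot twin of this seat's
`thetaLocal_untopD_le_sum_content_hull` (p437184), at the max-norm log-units (abc-iut-c312-3 `exists_family_isMaxOn_logUnits`,
`packetLogμ_packetHull_logPacket_eq_sum`); NO capsule symmetry is needed since only (Ind2) acts on the slot images.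
[cite: Mochizuki2012, IUTchIV Thm. 1.10 Step (v) p. 27–28] [cite: DupuyHilado2025, §4.12] -/
theorem thetaSlotLocal_untopD_le_sum_content_hull (hmono : LogvolMono P) (i : Fin T.lstar)
    [Fintype (Pr.factorIdx (Cor312.Setting.labelSucc i))] [Fintype (T.Caps (Cor312.Setting.labelSucc i) → T.Fibre vQ)]
    (hdef : P.SlotHullDefined (Cor312.Setting.labelSucc i) vQ)
    (hframe : P.frame (Cor312.Setting.labelSucc i) vQ =
      HullFrame.ofComparison (Pr.factorField (Cor312.Setting.labelSucc i))
        (fun x => Pr.factorMap (Cor312.Setting.labelSucc i) x))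
    (hvol : ∀ R : ∀ e : T.Caps (Cor312.Setting.labelSucc i) → T.Fibre vQ, Set (Pr.X e),
      (∀ e, PacketAdm p (Pr.kk e) (R e)) →
        (S.D P.n).logvol (Cor312.Setting.labelSucc i) vQ
          (Pr.comparison (Cor312.Setting.labelSucc i) ⁻¹' Set.pi univ R) =
        ∑ e, Pr.w (Cor312.Setting.labelSucc i) e * packetLogμ p (Pr.kk e) (R e))
    (m : (T.Caps (Cor312.Setting.labelSucc i) → T.Fibre vQ) → ℤ)
    (h3 : P.thetaRegion3 (Cor312.Setting.labelSucc i) vQ ⊆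
      Pr.comparison (Cor312.Setting.labelSucc i) ⁻¹' Set.pi univ fun e =>
        ((p : ℚ_[p]) ^ m e) • (logPacket p (Pr.kk e) : Set (Pr.X e))) :
    (P.thetaSlotLocal (Cor312.Setting.labelSucc i) vQ).untopD 0 ≤
      ∑ e, Pr.w (Cor312.Setting.labelSucc i) e * (-(m e * Real.log p) +
        packetLogμ p (Pr.kk e) (packetHull p (Pr.kk e) (logPacket p (Pr.kk e) : Set (Pr.X e)))) := by
  haveI : Nonempty (T.Caps (Cor312.Setting.labelSucc i)) := ⟨0⟩
  have hz : ∀ e : T.Caps (Cor312.Setting.labelSucc i) → T.Fibre vQ, ∃ z : ∀ a, Pr.kk e a,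
      (∀ a, z a ∈ logUnits (Pr.kk e a)) ∧ ∀ a, ∀ w ∈ logUnits (Pr.kk e a), ‖w‖ ≤ ‖z a‖ :=
    fun e => exists_family_isMaxOn_logUnits p (Pr.kk e)
  choose z hzmem hzmax using hz
  have hz0 : ∀ e a, z e a ≠ 0 := fun e a => ne_zero_of_isMaxOn_logUnits p (Pr.kk e a) (hzmax e a)
  refine (thetaSlotLocal_untopD_le_sum_content Pr hmono i hdef hframe hvol m h3 z hz0
    (fun e => logPacket_subset_purePacket_smul_normalizedPacket_of_isMaxOn p (Pr.kk e) (hzmax e))).trans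
    (le_of_eq (Finset.sum_congr rfl fun e _ => ?_))
  rw [packetLogμ_packetHull_logPacket_eq_sum p (Pr.kk e) (hzmem e) (hzmax e)]


end Setting

end Summit.ABC.IUTFork.Cor312Vol

end

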